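import Summits.HodgeConjecture.CorCM.GaloisCertificateSplitExtension
import Summits.HodgeConjecture.CorCM.GaloisDicyclicImprimitiveTypes
import HarnessLib

/-!
# BAD is monotone along split extensions, FIELD FORM: a Galois CM field `K₀` with a primitive DEGENERATE CM type
# makes every Galois CM field `K ⊇ K₀` BAD whose restriction `Gal(K/ℚ) → Gal(K₀/ℚ)` splits through complex
# conjugation with `[K : K₀] ≥ 3`

COR-CM (cell `pub-hodgecm2`), binder seat b04 (gen 31), count-neutral own lane «Galois-CM-type classification»; sequel of
`CorCM/GaloisCertificateSplitExtension` (the split-extension lift of an annihilator CERTIFICATE).  KERNEL ONLY: theorems; no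
definition, no named fact, no `sorry`.  `HC_CM` is neither used nor claimed.

The lineage's BAD theorems are FIELD statements (`∃ Φ, IsPrimitive Φ ∧ ¬ IsNondegenerate Φ ∧ …`), while the monotonicity
results of gens 30–31 (`× C_n`, `× H`, `N ⋊ Γ₀`) consume model CERTIFICATES.  This file closes the gap («field-level transport»,
open since gen 29):
* §1 **`exists_int_certificate_of_rat`**, **`exists_certificate_of_not_isNondegenerate`** — the CONVERSE of gen 24's certificate
  format: on any model `e : Gal(K/ℚ) ≃* G₀` a PRIMITIVE DEGENERATE CM type `Φ` of a Galois CM field READS as an annihilator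
  certificate `(T₀, b)` with `b : G₀ → ℤ` (Hazama–Kubota: gen 20 `GaloisRank.isNondegenerate_iff_forall_annihilator` gives a
  rational antisymmetric annihilated weight, whose denominators are cleared; the left stabiliser is trivial by gen 20
  `GaloisRank.not_isPrimitive_iff_exists_leftStabiliser`).  So «BAD» and «certified BAD» are the same thing, and every
  certificate-consuming theorem of the lineage applies to every BAD field.
* §2 `restrictNormalHom_complexConj_of_tower` — complex conjugation of `K` restricts to complex conjugation of a normal CM
  subfield `K₀` (tower form `[Algebra K₀ K] [IsScalarTower ℚ K₀ K]` of gen 21's `AbelianAllTypes.restrictNormalHom_complexConj`);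
  `restrictNormalHom_restrictScalars_eq_one` — `Gal(K/K₀)` restricts trivially.
* §3 **THE FIELD THEOREM `exists_simple_degenerate_of_subfield_split`**: `K ⊇ K₀ ⊇ ℚ` Galois CM fields, a homomorphic SECTION
  `σ : Gal(K₀/ℚ) →* Gal(K/ℚ)` of the restriction whose image contains complex conjugation, `[K : K₀] ≥ 3`, and a primitive
  degenerate CM type of `K₀` ⟹ `K` carries a SIMPLE DEGENERATE abelian variety of dimension `[K:ℚ]/2` with CM by `K` (a rational
  `(p,p)` class outside the divisor ring on some power).  Typical instance: `K = K₀ L` with `L` totally real, `K₀ ∩ L = ℚ`,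
  `[L:ℚ] ≥ 3` (`σ` = the inverse of restriction on `Gal(K/L) ∋ c`); in particular EVERY `Γ₀ ⋉ N`-field over a BAD `Γ₀`-field.
  **`exists_simple_degenerate_of_subfield_complement`** — the same with the section given as a SUBGROUP `Γ ≤ Gal(K/ℚ)`
  containing complex conjugation and meeting `Gal(K/K₀)` trivially with `|Γ| = [K₀:ℚ]`.
Consistency: the hypotheses fail exactly where they must — `Q₈ × C₂ ⊋ Q₈`-fields are not covered (`[K:K₀] = 2`), nor are the
GOOD `C_p ⋊ C₈` / `Q₈ × C_p` / `Dic_{2p}` fields (their CM quotient fields `C₈`, `Q₈`, `Q₈` are GOOD), nor non-split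
`C_{p²} ⋊ C₈ ⊋ C_p ⋊ C₈` (no complement).

## References

* [Kubota1965] T. Kubota, *On the field extension by complex multiplication*, Trans. AMS 118 (1965), §2, §4 Lemma 2.
* [Shimura1998] G. Shimura, *Abelian Varieties with Complex Multiplication and Modular Functions*, §6.2 Thm. 3, §8.2 Prop. 26,
  §18.2 Lemma (i).
* [Gordon1999HodgeAVSurvey] B. B. Gordon, *A survey of the Hodge conjecture for abelian varieties*, Thm. 6.4, §9.3.
* [Streng2010] M. Streng, *Complex multiplication of abelian surfaces*, Ch. I Lemma 2.2 (d).
-/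

noncomputable section

open CategoryTheory CategoryTheory.Limits NumberField
open scoped BigOperators

namespace Summit.HodgeConjecture.CorCM.GaloisModels

open Literature.NumberTheory.ComplexMultiplication
open Literature.AlgebraicGeometry.Motives (AbelianVariety CMType)
open Literature.AlgebraicGeometry.HodgeTheory
open Literature.AlgebraicGeometry.ComplexMultiplication (IsCMTypeRealisation)
open Literature.AlgebraicGeometry.Pohlmann1968
open Literature.Barriers.HodgeConjecture (divisorClassesSpan)
open Summit.HodgeConjecture.CorCM.GaloisRank
open NumberField.ComplexEmbedding

/-! ## §1 Every primitive degenerate type reads as an INTEGER annihilator certificate -/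

section Certificate

variable {G₀ : Type*} [Group G₀] [Fintype G₀]

omit [Group G₀] in
/-- **Clearing denominators**: a non-zero rational weight, antisymmetric under `y ↦ c₀ y` and annihilated by a family of
finite sums, has an INTEGER multiple with the same properties (`b' = (∏ den b) · b`). [folklore] -/
theorem exists_int_certificate_of_rat (mul : G₀ → G₀ → G₀) (c₀ : G₀) (T₀ : Finset G₀) (b : G₀ → ℚ)
    (hanti : ∀ y, b (mul c₀ y) = -b y) (hann : ∀ g : G₀, ∑ s ∈ T₀, b (mul s g) = 0) (hb : ∃ y, b y ≠ 0) :
    ∃ b' : G₀ → ℤ, (∀ y, b' (mul c₀ y) = -b' y) ∧ (∀ g : G₀, ∑ s ∈ T₀, b' (mul s g) = 0) ∧ ∃ y, b' y ≠ 0 := by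
  classical
  -- `b' y = (∏_{y' ≠ y} den (b y')) · num (b y)`, so that `b' y = d · b y` with `d = ∏ den`
  set d : ℕ := ∏ y, (b y).den with hd_def
  have hd : (d : ℚ) ≠ 0 := by
    rw [hd_def, Nat.cast_prod]
    exact Finset.prod_ne_zero_iff.2 fun y _ => Nat.cast_ne_zero.2 (b y).den_nz
  refine ⟨fun y => (∏ y' ∈ Finset.univ.erase y, ((b y').den : ℤ)) * (b y).num, ?_, ?_, ?_⟩
  · have hkey : ∀ y, (((∏ y' ∈ Finset.univ.erase y, ((b y').den : ℤ)) * (b y).num : ℤ) : ℚ) = d * b y := fun y => by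
      push_cast
      rw [hd_def, ← Finset.prod_erase_mul _ _ (Finset.mem_univ y), Nat.cast_mul, Nat.cast_prod, mul_assoc,
        mul_comm ((b y).den : ℚ), Rat.mul_den_eq_num]
    intro y
    have h : (((∏ y' ∈ Finset.univ.erase (mul c₀ y), ((b y').den : ℤ)) * (b (mul c₀ y)).num : ℤ) : ℚ) =
        -(((∏ y' ∈ Finset.univ.erase y, ((b y').den : ℤ)) * (b y).num : ℤ) : ℚ) := by
      rw [hkey, hkey, hanti, mul_neg]
    exact_mod_cast h
  · have hkey : ∀ y, (((∏ y' ∈ Finset.univ.erase y, ((b y').den : ℤ)) * (b y).num : ℤ) : ℚ) = d * b y := fun y => by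
      push_cast
      rw [hd_def, ← Finset.prod_erase_mul _ _ (Finset.mem_univ y), Nat.cast_mul, Nat.cast_prod, mul_assoc,
        mul_comm ((b y).den : ℚ), Rat.mul_den_eq_num]
    intro g
    have h : ((∑ s ∈ T₀, (∏ y' ∈ Finset.univ.erase (mul s g), ((b y').den : ℤ)) * (b (mul s g)).num : ℤ) : ℚ) = 0 := by
      push_cast
      have : ∀ s ∈ T₀, (((∏ y' ∈ Finset.univ.erase (mul s g), ((b y').den : ℤ)) * (b (mul s g)).num : ℤ) : ℚ) =
          d * b (mul s g) := fun s _ => hkey (mul s g)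
      push_cast at this
      rw [Finset.sum_congr rfl this, ← Finset.mul_sum, hann g, mul_zero]
    exact_mod_cast h
  · have hkey : ∀ y, (((∏ y' ∈ Finset.univ.erase y, ((b y').den : ℤ)) * (b y).num : ℤ) : ℚ) = d * b y := fun y => by
      push_cast
      rw [hd_def, ← Finset.prod_erase_mul _ _ (Finset.mem_univ y), Nat.cast_mul, Nat.cast_prod, mul_assoc,
        mul_comm ((b y).den : ℚ), Rat.mul_den_eq_num]
    obtain ⟨y, hy⟩ := hb
    refine ⟨y, fun h => ?_⟩
    have h' : (((∏ y' ∈ Finset.univ.erase y, ((b y').den : ℤ)) * (b y).num : ℤ) : ℚ) = 0 := by exact_mod_cast h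
    rw [hkey] at h'
    exact (mul_ne_zero hd hy) h'

variable [DecidableEq G₀]
variable {K : Type} [Field K] [NumberField K] [IsCMField K] [IsGalois ℚ K]

/-- **THE CONVERSE OF THE CERTIFICATE FORMAT: a primitive DEGENERATE CM type of a Galois CM field reads, on any model
`e : Gal(K/ℚ) ≃* G₀`, as an annihilator certificate** — the set `T₀ = {y : σ_{e⁻¹y} ∈ Φ}` is a CM set for `c₀ = e(c)` with
trivial left stabiliser, and some non-zero `c₀`-antisymmetric INTEGER weight is annihilated by all right translates of `T₀`
(Hazama–Kubota rank criterion, denominators cleared). [cite: Kubota1965, §2] [cite: Shimura1998, §8.2 Prop. 26]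
[cite: Gordon1999HodgeAVSurvey, §9.3] -/
theorem exists_certificate_of_not_isNondegenerate (e : (K ≃ₐ[ℚ] K) ≃* G₀) {c₀ : G₀}
    (hc : e ((IsCMField.complexConj K).restrictScalars ℚ) = c₀) (Φ : CMType K) (φ₀ : K →+* ℂ)
    (hprim : IsPrimitive (ℂ ≃+* ℂ) Φ.1 φ₀) (hdeg : ¬ IsNondegenerate Φ) :
    ∃ (T₀ : Finset G₀) (b : G₀ → ℤ), (∀ y : G₀, y ∈ T₀ ↔ embOf φ₀ (e.symm y) ∈ Φ.1) ∧
      (∀ x : G₀, x ∈ T₀ ↔ c₀ * x ∉ T₀) ∧ (∀ v : G₀, v ≠ 1 → ∃ w : G₀, ¬ (w ∈ T₀ ↔ v * w ∈ T₀)) ∧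
      (∀ y, b (c₀ * y) = -b y) ∧ (∀ g : G₀, ∑ s ∈ T₀, b (s * g) = 0) ∧ ∃ y, b y ≠ 0 := by
  classical
  set T₀ : Finset G₀ := Finset.univ.filter fun y => embOf φ₀ (e.symm y) ∈ Φ.1 with hT₀_def
  have hS : ∀ y : G₀, y ∈ T₀ ↔ embOf φ₀ (e.symm y) ∈ Φ.1 := fun y => by
    rw [hT₀_def, Finset.mem_filter, and_iff_right (Finset.mem_univ y)]
  -- CM
  have hcm : ∀ x : G₀, x ∈ T₀ ↔ c₀ * x ∉ T₀ := fun x => by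
    rw [model_mul_mem_iff e hc Φ φ₀ T₀ hS x, not_not]
  -- trivial left stabiliser
  have hprim' : ∀ v : G₀, v ≠ 1 → ∃ w : G₀, ¬ (w ∈ T₀ ↔ v * w ∈ T₀) := by
    intro v hv
    by_contra h
    refine (not_isPrimitive_iff_exists_leftStabiliser e Φ φ₀ T₀ hS).2 ⟨v, hv, fun w => ?_⟩ hprim
    by_contra h'
    exact h ⟨w, h'⟩
  -- a rational annihilated antisymmetric weight
  obtain ⟨b, hanti, hann, hb⟩ : ∃ b : G₀ → ℚ, (∀ y, b (c₀ * y) = -b y) ∧ (∀ g : G₀, ∑ s ∈ T₀, b (s * g) = 0) ∧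
      ∃ y, b y ≠ 0 := by
    by_contra h
    refine hdeg ((isNondegenerate_iff_forall_annihilator e hc Φ φ₀ T₀ hS).2 fun b hb1 hb2 => ?_)
    by_contra hb0
    exact h ⟨b, hb1, hb2, Function.ne_iff.1 hb0⟩
  obtain ⟨b', hanti', hann', hb'⟩ := exists_int_certificate_of_rat (· * ·) c₀ T₀ b hanti hann hb
  exact ⟨T₀, b', hS, hcm, hprim', hanti', hann', hb'⟩

end Certificate

/-! ## §2 Restriction to a normal CM subfield: complex conjugation and the kernel -/

section Tower

variable {K : Type} [Field K] [NumberField K] [IsCMField K]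
variable (K₀ : Type) [Field K₀] [NumberField K₀] [IsCMField K₀] [Algebra K₀ K] [IsScalarTower ℚ K₀ K] [Normal ℚ K₀]

/-- **`c|_{K₀} = c_{K₀}`** (tower form): the restriction of the complex conjugation of a CM field `K`, normal over `ℚ`, to a
normal CM subfield `K₀` is the complex conjugation of `K₀` — both are the conjugation of the embedding `ψ ∘ (K₀ → K)`.
[cite: Streng2010, Ch. I Lemma 2.2 (d)] [cite: Shimura1998, §18.2 Lemma (i)] -/
theorem restrictNormalHom_complexConj_of_tower [Normal ℚ K] :
    AlgEquiv.restrictNormalHom K₀ ((IsCMField.complexConj K).restrictScalars ℚ) =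
      (IsCMField.complexConj K₀).restrictScalars ℚ := by
  obtain ⟨ψ⟩ := (inferInstance : Nonempty (K →+* ℂ))
  have h1 : IsConj (ψ.comp (algebraMap K₀ K))
      (AlgEquiv.restrictNormalHom K₀ ((IsCMField.complexConj K).restrictScalars ℚ)) := by
    refine RingHom.ext fun x => ?_
    change starRingEnd ℂ (ψ (algebraMap K₀ K x)) =
      ψ (algebraMap K₀ K ((((IsCMField.complexConj K).restrictScalars ℚ).restrictNormal K₀) x))
    rw [AlgEquiv.restrictNormal_commutes, AlgEquiv.restrictScalars_apply, IsCMField.complexEmbedding_complexConj]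
  have h2 : IsConj (ψ.comp (algebraMap K₀ K)) ((IsCMField.complexConj K₀).restrictScalars ℚ) := by
    change conjugate (ψ.comp (algebraMap K₀ K)) = (ψ.comp (algebraMap K₀ K)).comp _
    exact IsCMField.isConj_complexConj K₀ (ψ.comp (algebraMap K₀ K))
  exact h1.ext h2

omit [IsCMField K] [IsCMField K₀] in
/-- `Gal(K/K₀)` restricts trivially to `K₀`. [folklore] -/
theorem restrictNormalHom_restrictScalars_eq_one [Normal ℚ K] (g : K ≃ₐ[K₀] K) :
    AlgEquiv.restrictNormalHom K₀ (g.restrictScalars ℚ) = 1 := by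
  refine AlgEquiv.ext fun x => (algebraMap K₀ K).injective ?_
  rw [AlgEquiv.one_apply]
  change algebraMap K₀ K ((g.restrictScalars ℚ).restrictNormal K₀ x) = _
  rw [AlgEquiv.restrictNormal_commutes, AlgEquiv.restrictScalars_apply, AlgEquiv.commutes]

omit [IsCMField K] [IsCMField K₀] in
/-- An automorphism restricting trivially to `K₀` fixes `K₀` pointwise. [folklore] -/
theorem apply_algebraMap_of_restrictNormalHom_eq_one [Normal ℚ K] {g : K ≃ₐ[ℚ] K}
    (hg : AlgEquiv.restrictNormalHom K₀ g = 1) (x : K₀) : g (algebraMap K₀ K x) = algebraMap K₀ K x := by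
  have h := AlgEquiv.restrictNormal_commutes g K₀ x
  rw [show g.restrictNormal K₀ = AlgEquiv.restrictNormalHom K₀ g from rfl, hg, AlgEquiv.one_apply] at h
  exact h.symm

end Tower

/-! ## §3 THE FIELD THEOREM -/

section Field

variable {K : Type} [Field K] [NumberField K] [IsCMField K] [IsGalois ℚ K]
variable (K₀ : Type) [Field K₀] [NumberField K₀] [IsCMField K₀] [IsGalois ℚ K₀] [Algebra K₀ K] [IsScalarTower ℚ K₀ K]

/-- **BAD IS MONOTONE ALONG SPLIT EXTENSIONS (field form).**  `K ⊇ K₀ ⊇ ℚ` Galois CM fields; `σ : Gal(K₀/ℚ) →* Gal(K/ℚ)` a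
homomorphic section of the restriction map whose image contains complex conjugation (e.g. the inverse of restriction on
`Gal(K/L)` for a totally real `L` with `K = K₀L`, `K₀ ∩ L = ℚ`); `[K : K₀] ≥ 3`; and `K₀` has a PRIMITIVE DEGENERATE CM
type ⟹ `K` carries a SIMPLE DEGENERATE abelian variety of dimension `[K:ℚ]/2` with CM by `K` (a rational `(p,p)` class
outside the divisor ring on some power). [cite: Kubota1965, §2 and §4 Lemma 2] [cite: Shimura1998, §6.2 Thm. 3 and §8.2 Prop. 26]
[cite: Gordon1999HodgeAVSurvey, Thm. 6.4 and §9.3] -/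
theorem exists_simple_degenerate_of_subfield_split (σ : (K₀ ≃ₐ[ℚ] K₀) →* (K ≃ₐ[ℚ] K))
    (hσ : ∀ q, AlgEquiv.restrictNormalHom K₀ (σ q) = q)
    (hc : ∃ q, σ q = (IsCMField.complexConj K).restrictScalars ℚ) (hdeg : 3 ≤ Module.finrank K₀ K)
    (Φ₀ : CMType K₀) (φ₀ : K₀ →+* ℂ) (hprim : IsPrimitive (ℂ ≃+* ℂ) Φ₀.1 φ₀) (hndg : ¬ IsNondegenerate Φ₀) :
    ∃ (Φ : CMType K) (φ : K →+* ℂ) (X : AbelianVariety ℂ) (ι : 𝓞 K →+* End X)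
      (ϑ : K →+* Module.End ℂ (complexBetti X.X 1)),
      IsPrimitive (ℂ ≃+* ℂ) Φ.1 φ ∧ ¬ IsNondegenerate Φ ∧ IsCMTypeRealisation Φ X ι ϑ ∧ X.IsSimple ∧
      X.dim = Module.finrank ℚ K / 2 ∧
      ∃ m p : ℕ, ∃ y : complexBetti (⨁ fun _ : Fin m => X).X (2 * p), IsRationalClass y ∧
        IsOfHodgeType (⨁ fun _ : Fin m => X).dim (⨁ fun _ : Fin m => X).X (2 * p) p p y ∧
        y ∉ divisorClassesSpan (⨁ fun _ : Fin m => X).X (⨁ fun _ : Fin m => X).dim p := by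
  classical
  -- complex conjugation is `σ` of the complex conjugation of `K₀`
  have hc' : (MulEquiv.refl (K ≃ₐ[ℚ] K)) ((IsCMField.complexConj K).restrictScalars ℚ) =
      σ ((IsCMField.complexConj K₀).restrictScalars ℚ) := by
    obtain ⟨q, hq⟩ := hc
    have hq' : q = (IsCMField.complexConj K₀).restrictScalars ℚ := by
      rw [← hσ q, hq, restrictNormalHom_complexConj_of_tower K₀]
    rw [MulEquiv.refl_apply, ← hq, hq']
  -- two distinct non-trivial elements of `Gal(K/K₀)`, restricting trivially to `K₀`
  haveI : FiniteDimensional K₀ K := Module.Finite.of_restrictScalars_finite ℚ K₀ K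
  haveI : IsGalois K₀ K := IsGalois.tower_top_of_isGalois ℚ K₀ K
  have hcard : 2 < Nat.card (K ≃ₐ[K₀] K) := by rw [IsGalois.card_aut_eq_finrank]; omega
  haveI : Finite (K ≃ₐ[K₀] K) := Nat.finite_of_card_ne_zero (by omega)
  letI : Fintype (K ≃ₐ[K₀] K) := Fintype.ofFinite _
  rw [Nat.card_eq_fintype_card] at hcard
  obtain ⟨g₁, g₂, hg₁, hg₂, hg₁₂⟩ : ∃ g₁ g₂ : K ≃ₐ[K₀] K, g₁ ≠ 1 ∧ g₂ ≠ 1 ∧ g₁ ≠ g₂ := by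
    obtain ⟨a, b, c, hab, hac, hbc⟩ := Fintype.two_lt_card_iff.1 hcard
    by_cases ha : a = 1
    · exact ⟨b, c, fun h => hab (ha.trans h.symm), fun h => hac (ha.trans h.symm), hbc⟩
    · by_cases hb : b = 1
      · exact ⟨a, c, ha, fun h => hbc (hb.trans h.symm), hac⟩
      · exact ⟨a, b, ha, hb, hab⟩
  have hinj : Function.Injective (AlgEquiv.restrictScalars ℚ : (K ≃ₐ[K₀] K) → (K ≃ₐ[ℚ] K)) :=
    AlgEquiv.restrictScalars_injective ℚ
  have hone : ((1 : K ≃ₐ[K₀] K).restrictScalars ℚ : K ≃ₐ[ℚ] K) = 1 := AlgEquiv.ext fun x => rfl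
  have h₁ : (g₁.restrictScalars ℚ : K ≃ₐ[ℚ] K) ≠ 1 := fun h => hg₁ (hinj (h.trans hone.symm))
  have h₂ : (g₂.restrictScalars ℚ : K ≃ₐ[ℚ] K) ≠ 1 := fun h => hg₂ (hinj (h.trans hone.symm))
  have h₁₂ : (g₁.restrictScalars ℚ : K ≃ₐ[ℚ] K) ≠ g₂.restrictScalars ℚ := fun h => hg₁₂ (hinj h)
  -- the certificate of `K₀`, read on `Gal(K₀/ℚ)` itself
  obtain ⟨T₀, b, -, hcm, hprim', hanti, hann, hb⟩ :=
    exists_certificate_of_not_isNondegenerate (MulEquiv.refl (K₀ ≃ₐ[ℚ] K₀))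
      (c₀ := (IsCMField.complexConj K₀).restrictScalars ℚ) rfl Φ₀ φ₀ hprim hndg
  obtain ⟨Φ, φ, X, ι, ϑ, H1, H2, H3, H4, H5, H6⟩ :=
    exists_simple_degenerate_of_split_certificate (MulEquiv.refl (K ≃ₐ[ℚ] K)) (AlgEquiv.restrictNormalHom K₀) σ hσ
      (n₁ := g₁.restrictScalars ℚ) (n₂ := g₂.restrictScalars ℚ) (restrictNormalHom_restrictScalars_eq_one K₀ g₁)
      (restrictNormalHom_restrictScalars_eq_one K₀ g₂) h₁ h₂ h₁₂ _ hc' T₀ hcm hprim' b hanti hann hb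
  refine ⟨Φ, φ, X, ι, ϑ, H1, H2, H3, H4, ?_, H6⟩
  rw [H5, card_model_eq_finrank (MulEquiv.refl (K ≃ₐ[ℚ] K))]

/-- **… with the section given as a SUBGROUP**: `Γ ≤ Gal(K/ℚ)` containing complex conjugation, meeting `Gal(K/K₀)` trivially,
with `|Γ| = [K₀:ℚ]` (so `Gal(K/ℚ) = Gal(K/K₀) ⋊ Γ`; e.g. `Γ = Gal(K/L)` for a totally real `L` with `K = K₀L`, `K₀ ∩ L = ℚ`),
`[K : K₀] ≥ 3`, and a primitive degenerate CM type of `K₀` ⟹ `K` carries a simple degenerate abelian variety of dimension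
`[K:ℚ]/2` with CM by `K`. [cite: Kubota1965, §2 and §4 Lemma 2] [cite: Shimura1998, §6.2 Thm. 3 and §8.2 Prop. 26]
[cite: Gordon1999HodgeAVSurvey, Thm. 6.4 and §9.3] -/
theorem exists_simple_degenerate_of_subfield_complement (Γ : Subgroup (K ≃ₐ[ℚ] K))
    (hcΓ : (IsCMField.complexConj K).restrictScalars ℚ ∈ Γ)
    (hdisj : ∀ g ∈ Γ, AlgEquiv.restrictNormalHom K₀ g = 1 → g = 1) (hcard : Nat.card Γ = Module.finrank ℚ K₀)
    (hdeg : 3 ≤ Module.finrank K₀ K) (Φ₀ : CMType K₀) (φ₀ : K₀ →+* ℂ) (hprim : IsPrimitive (ℂ ≃+* ℂ) Φ₀.1 φ₀)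
    (hndg : ¬ IsNondegenerate Φ₀) :
    ∃ (Φ : CMType K) (φ : K →+* ℂ) (X : AbelianVariety ℂ) (ι : 𝓞 K →+* End X)
      (ϑ : K →+* Module.End ℂ (complexBetti X.X 1)),
      IsPrimitive (ℂ ≃+* ℂ) Φ.1 φ ∧ ¬ IsNondegenerate Φ ∧ IsCMTypeRealisation Φ X ι ϑ ∧ X.IsSimple ∧
      X.dim = Module.finrank ℚ K / 2 ∧
      ∃ m p : ℕ, ∃ y : complexBetti (⨁ fun _ : Fin m => X).X (2 * p), IsRationalClass y ∧
        IsOfHodgeType (⨁ fun _ : Fin m => X).dim (⨁ fun _ : Fin m => X).X (2 * p) p p y ∧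
        y ∉ divisorClassesSpan (⨁ fun _ : Fin m => X).X (⨁ fun _ : Fin m => X).dim p := by
  -- restriction is a bijection `Γ ≃* Gal(K₀/ℚ)`
  set ρ : Γ →* (K₀ ≃ₐ[ℚ] K₀) := (AlgEquiv.restrictNormalHom K₀).restrict Γ with hρ_def
  have hρinj : Function.Injective ρ := by
    intro x y h
    apply Subtype.ext
    have h' : AlgEquiv.restrictNormalHom K₀ ((x : K ≃ₐ[ℚ] K) * (y : K ≃ₐ[ℚ] K)⁻¹) = 1 := by
      rw [map_mul, map_inv, mul_inv_eq_one]
      exact h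
    exact mul_inv_eq_one.1 (hdisj _ (Γ.mul_mem x.2 (Γ.inv_mem y.2)) h')
  have hρbij : Function.Bijective ρ := hρinj.bijective_of_nat_card_le (by rw [IsGalois.card_aut_eq_finrank, hcard])
  set ε : Γ ≃* (K₀ ≃ₐ[ℚ] K₀) := MulEquiv.ofBijective ρ hρbij with hε_def
  have hε : ∀ x : Γ, ε x = AlgEquiv.restrictNormalHom K₀ (x : K ≃ₐ[ℚ] K) := fun x => rfl
  refine exists_simple_degenerate_of_subfield_split K₀ (Γ.subtype.comp ε.symm.toMonoidHom) (fun q => ?_)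
    ⟨ε ⟨_, hcΓ⟩, ?_⟩ hdeg Φ₀ φ₀ hprim hndg
  · rw [MonoidHom.comp_apply, MulEquiv.coe_toMonoidHom, Subgroup.coe_subtype, ← hε, MulEquiv.apply_symm_apply]
  · rw [MonoidHom.comp_apply, MulEquiv.coe_toMonoidHom, MulEquiv.symm_apply_apply, Subgroup.coe_subtype]

end Field

end Summit.HodgeConjecture.CorCM.GaloisModels

end
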